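import Summits.AtomisticToContinuum.Crystallization.Theorems.ExcessDecayLiouvilleNonlinearCaccioppoliStep
import Summits.AtomisticToContinuum.Crystallization.Theorems.ExcessDecayLiouvilleVerticalDifferences

/-!
# Route `ExcessDecayLiouville`: lattice-difference sums on balls versus the nearest-neighbour form (nonlinear half, XII)

Harmonic-replacement architecture for item `ExcessDecay` (stmt-AtomisticToContinuum-9334), nonlinear half.
The far gradient data `𝐉[Δ_e h, Y]` of the linear step are fed by Caccioppoli bounds on the finite
nearest-neighbour forms `NN[v, c₀, R]`; the bridge from lattice differences on a ball to `NN` is: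

* `sum_translate_sq_le_NN` : for a lattice vector `τ ≠ 0` with `‖Aτ‖ ≤ 11/10`,
  `Σ_{q ∈ sites of B_R(c₀)} ‖v(q + Aτ) − v q‖² ≤ NN[v, c₀, R + 2]`;
* `sum_vertical_sq_le_NN` : for the two-layer vector `w₃` (not a bond; through the vertical two-step map
  of `ExcessDecayLiouvilleVerticalDifferences`), `Σ_{q ∈ sites of B_R(c₀)} ‖v(q + Aw₃) − v q‖² ≤ 4 NN[v, c₀, R + 3]`.

All `[folklore]`; helper lemmas, nothing here closes an item.
-/

noncomputable section

namespace Summit.AtomisticToContinuum.Crystallization.Theorems.ExcessDecayLiouville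

open scoped BigOperators Topology Classical
open Literature.MathematicalPhysics.StatisticalMechanics
open Summit.AtomisticToContinuum.Crystallization.Theorems.PhononStabilityNegative

section

variable {t : Fin 2 → (EuclideanSpace ℝ (Fin 3))} {A : (EuclideanSpace ℝ (Fin 3)) →L[ℝ] (EuclideanSpace ℝ (Fin 3))}
  {c₀ : EuclideanSpace ℝ (Fin 3)}

variable (hA : Adm₀ A) (hI : Inner₀ t A)

set_option quotPrecheck false in
-- Local notation: the finite near-neighbour form on the ball of radius `X` about `c₀`.
local notation "NN[" v ", " X "]" =>
  (∑ p ∈ (finite_sites_dist_le (t := t) (A := A) hA hI c₀ X).toFinset,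
    ∑ q ∈ (finite_sites_dist_le (t := t) (A := A) hA hI c₀ X).toFinset,
      (if p ≠ q ∧ dist p q ≤ 11 / 10 then ‖v p - v q‖ ^ 2 else (0 : ℝ)))

include hA hI in
/-- **A sum of single bond terms over a ball is below `NN` on a larger ball**: if `e : q ↦ (σ q, q)` takes
the sites of `B_R(c₀)` to ordered nearest-neighbour pairs of sites of `B_{R'}(c₀)`, then
`Σ_{q} ‖v(σ q) − v q‖² ≤ NN[v, c₀, R']`. [folklore] -/
theorem sum_pair_sq_le_NN (v : (EuclideanSpace ℝ (Fin 3)) → (EuclideanSpace ℝ (Fin 3))) {R R' : ℝ}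
    (σ : (EuclideanSpace ℝ (Fin 3)) → (EuclideanSpace ℝ (Fin 3)))
    (hσS : ∀ q ∈ Sites₀ t A, dist q c₀ ≤ R → σ q ∈ Sites₀ t A ∧ dist (σ q) c₀ ≤ R')
    (hRR' : R ≤ R') (hσne : ∀ q ∈ Sites₀ t A, σ q ≠ q) (hσnn : ∀ q ∈ Sites₀ t A, dist (σ q) q ≤ 11 / 10) :
    ∑ q ∈ (finite_sites_dist_le (t := t) (A := A) hA hI c₀ R).toFinset, ‖v (σ q) - v q‖ ^ 2 ≤ NN[v, R'] := by
  classical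
  have hmemF : ∀ q ∈ (finite_sites_dist_le (t := t) (A := A) hA hI c₀ R).toFinset, q ∈ Sites₀ t A ∧ dist q c₀ ≤ R :=
    fun q hq => by
      have h := (Set.Finite.mem_toFinset (finite_sites_dist_le (t := t) (A := A) hA hI c₀ R)).1 hq
      exact h
  have hmemF' : ∀ x : EuclideanSpace ℝ (Fin 3), x ∈ Sites₀ t A → dist x c₀ ≤ R' →
      x ∈ (finite_sites_dist_le (t := t) (A := A) hA hI c₀ R').toFinset :=
    fun x hx hxd => (Set.Finite.mem_toFinset _).2 ⟨hx, hxd⟩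
  -- the pair map
  let e : (EuclideanSpace ℝ (Fin 3)) → (EuclideanSpace ℝ (Fin 3)) × (EuclideanSpace ℝ (Fin 3)) := fun q => (σ q, q)
  have hinj : Set.InjOn e (finite_sites_dist_le (t := t) (A := A) hA hI c₀ R).toFinset := fun q _ q' _ h => (Prod.ext_iff.1 h).2
  have himg : (finite_sites_dist_le (t := t) (A := A) hA hI c₀ R).toFinset.image e ⊆
      (finite_sites_dist_le (t := t) (A := A) hA hI c₀ R').toFinset ×ˢ (finite_sites_dist_le (t := t) (A := A) hA hI c₀ R').toFinset := by
    intro x hx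
    rw [Finset.mem_image] at hx
    obtain ⟨q, hq, rfl⟩ := hx
    obtain ⟨hqS, hqd⟩ := hmemF q hq
    rw [Finset.mem_product]
    exact ⟨hmemF' _ (hσS q hqS hqd).1 (hσS q hqS hqd).2, hmemF' q hqS (hqd.trans hRR')⟩
  calc ∑ q ∈ (finite_sites_dist_le (t := t) (A := A) hA hI c₀ R).toFinset, ‖v (σ q) - v q‖ ^ 2
      = ∑ q ∈ (finite_sites_dist_le (t := t) (A := A) hA hI c₀ R).toFinset,
          (fun x : (EuclideanSpace ℝ (Fin 3)) × (EuclideanSpace ℝ (Fin 3)) =>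
            (if x.1 ≠ x.2 ∧ dist x.1 x.2 ≤ 11 / 10 then ‖v x.1 - v x.2‖ ^ 2 else (0 : ℝ))) (e q) := by
        refine Finset.sum_congr rfl fun q hq => ?_
        obtain ⟨hqS, -⟩ := hmemF q hq
        simp only [e]
        rw [if_pos ⟨hσne q hqS, hσnn q hqS⟩]
    _ = ∑ x ∈ (finite_sites_dist_le (t := t) (A := A) hA hI c₀ R).toFinset.image e,
          (if x.1 ≠ x.2 ∧ dist x.1 x.2 ≤ 11 / 10 then ‖v x.1 - v x.2‖ ^ 2 else (0 : ℝ)) :=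
        (Finset.sum_image (f := fun x : (EuclideanSpace ℝ (Fin 3)) × (EuclideanSpace ℝ (Fin 3)) =>
            (if x.1 ≠ x.2 ∧ dist x.1 x.2 ≤ 11 / 10 then ‖v x.1 - v x.2‖ ^ 2 else (0 : ℝ))) hinj).symm
    _ ≤ ∑ x ∈ (finite_sites_dist_le (t := t) (A := A) hA hI c₀ R').toFinset ×ˢ (finite_sites_dist_le (t := t) (A := A) hA hI c₀ R').toFinset,
          (if x.1 ≠ x.2 ∧ dist x.1 x.2 ≤ 11 / 10 then ‖v x.1 - v x.2‖ ^ 2 else (0 : ℝ)) :=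
        Finset.sum_le_sum_of_subset_of_nonneg himg fun x _ _ => by positivity
    _ = NN[v, R'] := by rw [Finset.sum_product]

include hA hI in
/-- **Nearest-neighbour lattice translations**: for `τ ∈ Λ₀`, `τ ≠ 0`, `‖Aτ‖ ≤ 11/10`,
`Σ_{q ∈ sites of B_R(c₀)} ‖v(q + Aτ) − v q‖² ≤ NN[v, c₀, R + 2]`. [folklore] -/
theorem sum_translate_sq_le_NN (v : (EuclideanSpace ℝ (Fin 3)) → (EuclideanSpace ℝ (Fin 3))) (R : ℝ)
    {τ : EuclideanSpace ℝ (Fin 3)} (hτ : τ ∈ Λ₀) (hτ0 : A τ ≠ 0) (hτn : ‖A τ‖ ≤ 11 / 10) :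
    ∑ q ∈ (finite_sites_dist_le (t := t) (A := A) hA hI c₀ R).toFinset, ‖v (q + A τ) - v q‖ ^ 2 ≤ NN[v, R + 2] := by
  refine sum_pair_sq_le_NN hA hI v (fun q => q + A τ) (fun q hq hqd => ⟨add_mem_sites₀ hq hτ, ?_⟩) (by linarith)
    (fun q _ h => hτ0 (by simpa using h)) (fun q _ => by rw [dist_eq_norm, add_sub_cancel_left]; exact hτn)
  have h1 : dist (q + A τ) q = ‖A τ‖ := by rw [dist_eq_norm, add_sub_cancel_left]
  have := dist_triangle (q + A τ) q c₀
  linarith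

include hA hI in
/-- **The two-layer translation through the vertical two-step map**:
`Σ_{q ∈ sites of B_R(c₀)} ‖v(q + Aw₃) − v q‖² ≤ 4 NN[v, c₀, R + 3]`. [folklore] -/
theorem sum_vertical_sq_le_NN (v : (EuclideanSpace ℝ (Fin 3)) → (EuclideanSpace ℝ (Fin 3))) (R : ℝ) :
    ∑ q ∈ (finite_sites_dist_le (t := t) (A := A) hA hI c₀ R).toFinset,
      ‖v (q + A (layerNormal (2 * Real.sqrt (2 / 3)))) - v q‖ ^ 2 ≤ 4 * NN[v, R + 3] := by
  classical
  obtain ⟨σ, hσinj, hσnn, hσσ⟩ := exists_verticalStep hA hI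
  -- extend σ to a self-map of E3
  let σ' : (EuclideanSpace ℝ (Fin 3)) → (EuclideanSpace ℝ (Fin 3)) := fun q =>
    if hq : q ∈ Sites₀ t A then ((σ ⟨q, hq⟩ : Sites₀ t A) : EuclideanSpace ℝ (Fin 3)) else q
  have hσ'eq : ∀ q (hq : q ∈ Sites₀ t A), σ' q = ((σ ⟨q, hq⟩ : Sites₀ t A) : EuclideanSpace ℝ (Fin 3)) := by
    intro q hq; simp only [σ', dif_pos hq]
  have hσ'S : ∀ q (hq : q ∈ Sites₀ t A), σ' q ∈ Sites₀ t A := fun q hq => by rw [hσ'eq q hq]; exact (σ ⟨q, hq⟩).2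
  have hσ'nn : ∀ q ∈ Sites₀ t A, dist (σ' q) q ≤ 11 / 10 := fun q hq => by
    rw [hσ'eq q hq, dist_comm]; exact hσnn ⟨q, hq⟩
  have hσ'σ' : ∀ q (hq : q ∈ Sites₀ t A), σ' (σ' q) = q + A (layerNormal (2 * Real.sqrt (2 / 3))) := by
    intro q hq
    rw [hσ'eq (σ' q) (hσ'S q hq)]
    have : (⟨σ' q, hσ'S q hq⟩ : Sites₀ t A) = σ ⟨q, hq⟩ := Subtype.ext (hσ'eq q hq)
    rw [this]; exact hσσ ⟨q, hq⟩
  have hAw : A (layerNormal (2 * Real.sqrt (2 / 3))) ≠ 0 := by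
    intro h
    obtain ⟨-, -, hk⟩ := abs_coord_le_norm_apply_latticeVec hA 0 0 1
    simp only [Int.cast_zero, zero_smul, zero_add, Int.cast_one, one_smul, abs_one] at hk
    rw [h, norm_zero, mul_zero] at hk
    linarith
  have hσ'ne : ∀ q ∈ Sites₀ t A, σ' q ≠ q := by
    intro q hq h
    have h2 := hσ'σ' q hq
    rw [h, h] at h2
    exact hAw (by have := h2; simpa using this.symm)
  have hσ'inj : ∀ q ∈ Sites₀ t A, ∀ q' ∈ Sites₀ t A, σ' q = σ' q' → q = q' := by
    intro q hq q' hq' h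
    rw [hσ'eq q hq, hσ'eq q' hq'] at h
    have := hσinj (Subtype.ext h)
    exact congrArg Subtype.val this
  have hmemF : ∀ q ∈ (finite_sites_dist_le (t := t) (A := A) hA hI c₀ R).toFinset, q ∈ Sites₀ t A ∧ dist q c₀ ≤ R :=
    fun q hq => by
      have h := (Set.Finite.mem_toFinset (finite_sites_dist_le (t := t) (A := A) hA hI c₀ R)).1 hq
      exact h
  -- split the two-layer difference along the two steps
  have hsplit : ∀ q ∈ (finite_sites_dist_le (t := t) (A := A) hA hI c₀ R).toFinset,
      ‖v (q + A (layerNormal (2 * Real.sqrt (2 / 3)))) - v q‖ ^ 2 ≤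
        2 * ‖v (σ' (σ' q)) - v (σ' q)‖ ^ 2 + 2 * ‖v (σ' q) - v q‖ ^ 2 := by
    intro q hq
    rw [← hσ'σ' q (hmemF q hq).1]
    have e : v (σ' (σ' q)) - v q = (v (σ' (σ' q)) - v (σ' q)) + (v (σ' q) - v q) := by abel
    rw [e]
    nlinarith [norm_add_le (v (σ' (σ' q)) - v (σ' q)) (v (σ' q) - v q),
      sq_nonneg (‖v (σ' (σ' q)) - v (σ' q)‖ - ‖v (σ' q) - v q‖), norm_nonneg (v (σ' (σ' q)) - v (σ' q) + (v (σ' q) - v q))]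
  refine (Finset.sum_le_sum hsplit).trans ?_
  rw [Finset.sum_add_distrib, ← Finset.mul_sum, ← Finset.mul_sum]
  -- the second step sum
  have h2 : ∑ q ∈ (finite_sites_dist_le (t := t) (A := A) hA hI c₀ R).toFinset, ‖v (σ' q) - v q‖ ^ 2 ≤ NN[v, R + 3] :=
    sum_pair_sq_le_NN hA hI v σ' (fun q hq hqd => ⟨hσ'S q hq, by
      have := dist_triangle (σ' q) q c₀; linarith [hσ'nn q hq]⟩) (by linarith) hσ'ne hσ'nn
  -- the first step sum, reindexed by `q' = σ' q`
  have himg : (finite_sites_dist_le (t := t) (A := A) hA hI c₀ R).toFinset.image σ' ⊆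
      (finite_sites_dist_le (t := t) (A := A) hA hI c₀ (R + 11 / 10)).toFinset := by
    intro x hx
    rw [Finset.mem_image] at hx
    obtain ⟨q, hq, rfl⟩ := hx
    obtain ⟨hqS, hqd⟩ := hmemF q hq
    refine (Set.Finite.mem_toFinset _).2 ⟨hσ'S q hqS, ?_⟩
    have := dist_triangle (σ' q) q c₀; linarith [hσ'nn q hqS]
  have hinjF : Set.InjOn σ' (finite_sites_dist_le (t := t) (A := A) hA hI c₀ R).toFinset :=
    fun q hq q' hq' h => hσ'inj q (hmemF q hq).1 q' (hmemF q' hq').1 h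
  have h1 : ∑ q ∈ (finite_sites_dist_le (t := t) (A := A) hA hI c₀ R).toFinset, ‖v (σ' (σ' q)) - v (σ' q)‖ ^ 2 ≤ NN[v, R + 3] := by
    calc _ = ∑ q' ∈ (finite_sites_dist_le (t := t) (A := A) hA hI c₀ R).toFinset.image σ', ‖v (σ' q') - v q'‖ ^ 2 :=
          (Finset.sum_image hinjF).symm
      _ ≤ ∑ q' ∈ (finite_sites_dist_le (t := t) (A := A) hA hI c₀ (R + 11 / 10)).toFinset, ‖v (σ' q') - v q'‖ ^ 2 :=
          Finset.sum_le_sum_of_subset_of_nonneg himg fun _ _ _ => sq_nonneg _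
      _ ≤ NN[v, R + 3] :=
          sum_pair_sq_le_NN hA hI v σ' (fun q hq hqd => ⟨hσ'S q hq, by
            have := dist_triangle (σ' q) q c₀; linarith [hσ'nn q hq]⟩) (by linarith) hσ'ne hσ'nn
  linarith

end

end Summit.AtomisticToContinuum.Crystallization.Theorems.ExcessDecayLiouville

end
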